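import Mathlib.Data.Fintype.Pigeonhole
import Literature.AlgebraicGeometry.Motives.FaltingsEC
import Literature.NumberTheory.EllipticCurves.TateModuleFinrankProofs
import HarnessLib

/-!
# Faltings' isogeny criterion for elliptic curves: reduction of Korollar 2 to Satz 4

D-0014 keeps `Literature/` sorry-free by stating cited results as named facts `def X : Prop`.
This sibling proof file of `Literature.AlgebraicGeometry.Motives.FaltingsEC` concerns the named
fact `Literature.Hodge.isIsogenous_iff_exists_tateModule_hom_ne_zero W W' ℓ`: two elliptic curves
`E, E'` over a number field `K` are isogenous over `K` iff there is a non-zero `ℤ_ℓ`-linear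
`Γ_K`-equivariant map `T_ℓ E → T_ℓ E'`.

## Source

G. Faltings, *Endlichkeitssätze für abelsche Varietäten über Zahlkörpern*, Invent. Math. **73**
(1983), 349–366, §5; English translation: *Finiteness theorems for abelian varieties over number
fields*, Ch. II of Cornell–Silverman (eds.), *Arithmetic Geometry*, Springer 1986, §5
"Endomorphisms" (read there). For an abelian variety `A` over a number field `K`, `ℓ` prime,
`π = Gal(K̄/K)`:

* Satz 3: the action of `π` on `T_ℓ(A) ⊗ ℚ_ℓ` is semisimple;
* Satz 4: `End_K(A) ⊗ ℤ_ℓ → End_π(T_ℓ(A))` is an isomorphism;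
* Korollar 1: `Hom_K(A₁, A₂) ⊗ ℤ_ℓ → Hom_π(T_ℓ(A₁), T_ℓ(A₂))` is an isomorphism
  ("Theorem 4 applied to `A₁ × A₂`");
* Korollar 2: equivalent are (i) `A₁, A₂` isogenous; (ii) `T_ℓ(A₁) ⊗ ℚ_ℓ ≅ T_ℓ(A₂) ⊗ ℚ_ℓ` as
  `π`-modules; (iii) `L_v(A₁, s) = L_v(A₂, s)` for almost all `v`; (iv) for all `v`
  ("(i) ⇔ (ii) follows from Theorem 4").

The vendored fact is the elliptic-curve reading of (i) ⇔ (ii) through Korollar 1: a non-zero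
element of `Hom_π(T_ℓ E, T_ℓ E') = Hom_K(E, E') ⊗ ℤ_ℓ` forces `Hom_K(E, E') ≠ 0`, and a non-zero
homomorphism of elliptic curves is an isogeny; conversely `T_ℓ` of an isogeny is non-zero. It is
a true consequence of the source (not stated more strongly than Korollar 1 permits).

## Contents (all proved)

* `Literature.NumberTheory.EllipticCurves.TateModule.mapAddMonoidHom_injective_of_finite_ker`, `Literature.NumberTheory.EllipticCurves.TateModule.map_injective_of_finite_ker`:
  for any additive map `f : A → B` with finite kernel, `T_p f : T_p A → T_p B` is injective
  (the components of an element of `ker T_p f` lie in the finite group `ker f` and have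
  unbounded order unless they all vanish).
* `Literature.AlgebraicGeometry.Motives.tateModule_map_injective`: `T_ℓ φ` is injective for every isogeny `φ` (any field,
  any Weierstrass curves); `Literature.AlgebraicGeometry.Motives.nontrivial_tateModule`: `T_ℓ E ≠ 0` for `E` elliptic and
  `ℓ ≠ char K` (from the tree's theorem `rank_{ℤ_ℓ} T_ℓ E = 2`,
  `WeierstrassCurve.finrank_tateModule_eq_two_holds`, Silverman *AEC* III.7.1(a));
  `Literature.AlgebraicGeometry.Motives.tateModule_map_ne_zero`: hence `T_ℓ φ ≠ 0`.
* `Literature.AlgebraicGeometry.Motives.exists_tateModule_hom_ne_zero_of_isIsogenous`: the direction (i) ⇒ of the fact,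
  unconditionally, over any field with `ℓ ≠ char K`.
* `Literature.AlgebraicGeometry.Motives.isIsogenous_iff_exists_tateModule_hom_ne_zero_of_span`: over any field with
  `ℓ ≠ char K`, the criterion follows from the surjectivity statement "every `Γ_K`-equivariant
  `T_ℓ E → T_ℓ E'` is in the `ℤ_ℓ`-span of the `T_ℓ φ`" (Korollar 1 / Tate's Main Theorem).
* `Literature.AlgebraicGeometry.Motives.isIsogenous_iff_exists_tateModule_hom_ne_zero_of_satz4`: **the named fact
  `isIsogenous_iff_exists_tateModule_hom_ne_zero W W' ℓ` follows from the named fact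
  `mem_span_range_tateModule_map_of_equivariant W W' ℓ`** (Faltings, Satz 4 / Korollar 1 for
  elliptic curves) — the printed deduction "(i) ⇔ (ii) follows from Theorem 4".
* `Literature.AlgebraicGeometry.Motives.isIsogenous_iff_exists_tateModule_hom_ne_zero_of_finite_of_tate`: the same
  deduction over a finite field, from `mem_span_range_tateModule_map_of_equivariant_of_finite`
  (Tate 1966, Main Theorem ⇒ Thm. 1(b)).

What is *not* proved here is Satz 4 itself (the Tate conjecture for endomorphisms over number
fields: Faltings' Theorems 1–2 on heights in isogeny classes plus Tate's argument), so the
discharge `isIsogenous_iff_exists_tateModule_hom_ne_zero_holds` is not asserted: it is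
`isIsogenous_iff_exists_tateModule_hom_ne_zero_of_satz4 W W' ℓ h` for a proof `h` of
`mem_span_range_tateModule_map_of_equivariant W W' ℓ`.

## References

* [Faltings1983Endlichkeit] G. Faltings, Invent. Math. 73 (1983), 349–366, §5: Satz 3, Satz 4,
  Korollar 1, Korollar 2 (English: Cornell–Silverman, *Arithmetic Geometry*, 1986, Ch. II §5,
  Theorems 3–4, Corollaries 1–2).
* [Tate1966Endomorphisms] J. Tate, Invent. Math. 2 (1966), 134–144, Main Theorem, Theorem 1.
* [SilvermanAEC2009] J. H. Silverman, *The Arithmetic of Elliptic Curves*, 2nd ed., GTM 106,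
  Prop. III.7.1(a), Thm. III.7.4 and Remark III.7.6, Isogeny Theorem III.7.7 (printed pp. 91–92;
  held PDF pp. 86–87).

## Design

Pure theorems, no new definitions. `noncomputable section`; universe-monomorphic carriers as in
the preludes; generic material in `namespace Literature.TateModule`, curve-specific theorems in
`namespace Literature.Hodge` next to the facts they serve.
-/

noncomputable section

open scoped AddSubgroup

universe u v

namespace Literature.AlgebraicGeometry.Motives
section TateModule
open Literature.NumberTheory.EllipticCurves (TateModule)
open Literature.NumberTheory.EllipticCurves.TateModule

/-! ## `T_p` of a map with finite kernel is injective -/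

variable {A : Type u} [AddCommGroup A] {B : Type v} [AddCommGroup B] {p : ℕ}

/-- If every component `a_n` of `a ∈ T_p A` lies in a finite subgroup `H ≤ A`, then `a = 0`:
by pigeonhole two components `a_{n+i} = a_{n+j}` (`i < j`) coincide, so `x = a_{n+i}` satisfies
`x = p^{j-i} • x`, whence `x = p^{m(j-i)} • x = 0` for `m` large (`x` is `p`-power torsion), and
`a_n = p^i • x = 0`. Silverman, *AEC*, III.§7 (the inverse limit `lim← E[ℓ^n]`). [folklore] -/
theorem _root_.Literature.NumberTheory.EllipticCurves.TateModule.eq_zero_of_forall_proj_mem {H : AddSubgroup A} (hH : (H : Set A).Finite) (a : TateModule A p)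
    (ha : ∀ n, proj p n a ∈ H) : a = 0 := by
  haveI : Finite H := hH.to_subtype
  refine TateModule.ext fun n ↦ ?_
  rw [map_zero]
  -- pigeonhole on the tail `i ↦ a_{n+i}`
  obtain ⟨i, j, hij, he⟩ := Finite.exists_ne_map_eq_of_infinite
    (fun i : ℕ ↦ (⟨proj p (n + i) a, ha (n + i)⟩ : H))
  have he' : proj p (n + i) a = proj p (n + j) a := congrArg Subtype.val he
  -- without loss of generality `i < j`
  wlog hlt : i < j generalizing i j
  · exact this j i hij.symm he.symm he'.symm (lt_of_le_of_ne (not_lt.mp hlt) hij.symm)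
  obtain ⟨d, rfl⟩ := Nat.exists_eq_add_of_lt hlt
  -- `x = a_{n+i}` satisfies `p^(d+1) • x = x`
  have hfix : p ^ (d + 1) • proj p (n + i) a = proj p (n + i) a := by
    conv_lhs => rw [he', show n + (i + d + 1) = (n + i) + (d + 1) by ring]
    exact pow_smul_proj_add a (n + i) (d + 1)
  -- hence `p^(m (d+1)) • x = x` for all `m`
  have hiter : ∀ m : ℕ, p ^ (m * (d + 1)) • proj p (n + i) a = proj p (n + i) a := by
    intro m
    induction m with
    | zero => simp
    | succ m ih => rw [Nat.succ_mul, pow_add, mul_smul, hfix, ih]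
  -- and `p^(n+i) • x = 0`, so `x = 0`
  have hx0 : proj p (n + i) a = 0 := by
    rw [← hiter (n + i)]
    obtain ⟨e, he⟩ := Nat.exists_eq_add_of_le
      (Nat.le_mul_of_pos_right (n + i) (Nat.succ_pos d) : n + i ≤ (n + i) * (d + 1))
    rw [he, add_comm, pow_add, mul_smul, pow_smul_proj, smul_zero]
  -- finally `a_n = p^i • x = 0`
  rw [← pow_smul_proj_add a n i, hx0, smul_zero]

/-- **`T_p` of an additive map with finite kernel is injective**: if `f : A → B` has finite
kernel then `T_p f : T_p A → T_p B`, `(a_n) ↦ (f a_n)`, is injective (all components of an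
element of the kernel lie in the finite group `ker f`). Applies to isogenies (Silverman, *AEC*,
III.§7, III.7.4). [folklore] -/
theorem _root_.Literature.NumberTheory.EllipticCurves.TateModule.mapAddMonoidHom_injective_of_finite_ker (f : A →+ B) (hf : (f.ker : Set A).Finite) :
    Function.Injective (mapAddMonoidHom p f) := by
  refine (injective_iff_map_eq_zero _).mpr fun a ha ↦ eq_zero_of_forall_proj_mem hf a fun n ↦ ?_
  rw [AddMonoidHom.mem_ker, ← proj_mapAddMonoidHom f a n, ha, map_zero]

/-- **`T_p` of an additive map with finite kernel is injective**, `ℤ_[p]`-linear version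
(`TateModule.map`). Silverman, *AEC*, III.§7. [folklore] -/
theorem _root_.Literature.NumberTheory.EllipticCurves.TateModule.map_injective_of_finite_ker [Fact p.Prime] (f : A →+ B) (hf : (f.ker : Set A).Finite) :
    Function.Injective (map p f) :=
  mapAddMonoidHom_injective_of_finite_ker f hf

end TateModule
end Literature.AlgebraicGeometry.Motives

namespace Literature.AlgebraicGeometry.Motives

open WeierstrassCurve

variable {K : Type u} [Field K] {W W' : WeierstrassCurve K} (ℓ : ℕ) [Fact ℓ.Prime]

/-! ## `T_ℓ φ ≠ 0` for an isogeny `φ` -/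

/-- The Tate-module map `T_ℓ φ` of an isogeny `φ : E → E'` (finite kernel) is injective, for
arbitrary Weierstrass curves over any field. Silverman, *AEC*, III.§7 (cf. III.7.4). [folklore] -/
theorem tateModule_map_injective (φ : Isogeny W W') :
    Function.Injective (Literature.NumberTheory.EllipticCurves.TateModule.map ℓ φ.toAddMonoidHom) :=
  Literature.NumberTheory.EllipticCurves.TateModule.map_injective_of_finite_ker _ φ.finite_ker

variable (W) in
/-- For an elliptic curve `E / K` and a prime `ℓ ≠ char K` the Tate module `T_ℓ E` is non-zero
(indeed `rank_{ℤ_ℓ} T_ℓ E = 2`, `WeierstrassCurve.finrank_tateModule_eq_two_holds`).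
Silverman, *AEC*, Prop. III.7.1(a). [cite: SilvermanAEC2009, Prop. III.7.1(a)] -/
theorem nontrivial_tateModule [W.IsElliptic] (hℓ : (ℓ : K) ≠ 0) : Nontrivial (W.tateModule ℓ) :=
  Module.nontrivial_of_finrank_eq_succ (R := ℤ_[ℓ]) (finrank_tateModule_eq_two_holds W ℓ hℓ)

/-- For an elliptic curve `E / K`, a prime `ℓ ≠ char K` and an isogeny `φ : E → E'` over `K`,
the Tate-module map `T_ℓ φ : T_ℓ E → T_ℓ E'` is non-zero (it is injective on the non-zero module
`T_ℓ E`). Silverman, *AEC*, III.7.4 (injectivity of `Hom ⊗ ℤ_ℓ → Hom(T_ℓ, T_ℓ)`).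
[cite: SilvermanAEC2009, Thm. III.7.4] -/
theorem tateModule_map_ne_zero [W.IsElliptic] (hℓ : (ℓ : K) ≠ 0) (φ : Isogeny W W') :
    Literature.NumberTheory.EllipticCurves.TateModule.map ℓ φ.toAddMonoidHom ≠ 0 := by
  haveI := nontrivial_tateModule W ℓ hℓ
  obtain ⟨x, hx⟩ := exists_ne (0 : W.tateModule ℓ)
  intro h
  exact hx (tateModule_map_injective ℓ φ (by rw [h, LinearMap.zero_apply, map_zero]))

/-! ## The isogeny criterion from the surjectivity of `Hom ⊗ ℤ_ℓ → Hom_Γ(T_ℓ, T_ℓ)` -/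

/-- **Isogenous curves have a non-zero Tate homomorphism** (direction (i) ⇒ (ii) of Faltings'
Korollar 2 / Tate's Theorem 1, elliptic-curve case, unconditionally): if `E` is elliptic,
`ℓ ≠ char K` and `E, E'` are isogenous over `K`, then `T_ℓ φ` of an isogeny `φ` is a non-zero
`ℤ_ℓ`-linear `Γ_K`-equivariant map `T_ℓ E → T_ℓ E'` (Silverman, *AEC*, Remark III.7.6: the map
`Hom_K(E₁, E₂) ⊗ ℤ_ℓ → Hom_K(T_ℓ(E₁), T_ℓ(E₂))` is injective by Thm. III.7.4).
[cite: SilvermanAEC2009, Remark III.7.6 with Thm. III.7.4] -/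
theorem exists_tateModule_hom_ne_zero_of_isIsogenous [W.IsElliptic] (hℓ : (ℓ : K) ≠ 0)
    (h : W.IsIsogenous W') :
    ∃ f : W.tateModule ℓ →ₗ[ℤ_[ℓ]] W'.tateModule ℓ,
      f ≠ 0 ∧ ∀ (σ : Field.absoluteGaloisGroup K) (x : W.tateModule ℓ), f (σ • x) = σ • f x := by
  obtain ⟨φ⟩ := h
  exact ⟨Literature.NumberTheory.EllipticCurves.TateModule.map ℓ φ.toAddMonoidHom, tateModule_map_ne_zero ℓ hℓ φ,
    tateModule_map_smul ℓ φ⟩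

/-- **The isogeny criterion from surjectivity.** Let `E` be elliptic over a field `K`, `E'` a
Weierstrass curve over `K` and `ℓ ≠ char K` a prime. If every `Γ_K`-equivariant `ℤ_ℓ`-linear map
`T_ℓ E → T_ℓ E'` lies in the `ℤ_ℓ`-span of the maps `T_ℓ φ` (`φ : E → E'` an isogeny over `K`) —
the surjectivity half of `Hom_K(E, E') ⊗ ℤ_ℓ ≅ Hom_{Γ_K}(T_ℓ E, T_ℓ E')` (Faltings, Korollar 1;
Tate, Main Theorem) — then `E, E'` are isogenous over `K` iff some such map is non-zero: a
non-zero element of the span needs a non-empty spanning family. This is the printed deduction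
"(i) ⇔ (ii) follows from Theorem 4". [cite: Faltings1983Endlichkeit, §5 Korollar 2, proof] -/
theorem isIsogenous_iff_exists_tateModule_hom_ne_zero_of_span [W.IsElliptic] (hℓ : (ℓ : K) ≠ 0)
    (hspan : ∀ f : W.tateModule ℓ →ₗ[ℤ_[ℓ]] W'.tateModule ℓ,
      (∀ (σ : Field.absoluteGaloisGroup K) (x : W.tateModule ℓ), f (σ • x) = σ • f x) →
      f ∈ Submodule.span ℤ_[ℓ]
        (Set.range fun φ : Isogeny W W' ↦ Literature.NumberTheory.EllipticCurves.TateModule.map ℓ φ.toAddMonoidHom)) :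
    W.IsIsogenous W' ↔
      ∃ f : W.tateModule ℓ →ₗ[ℤ_[ℓ]] W'.tateModule ℓ,
        f ≠ 0 ∧ ∀ (σ : Field.absoluteGaloisGroup K) (x : W.tateModule ℓ), f (σ • x) = σ • f x := by
  refine ⟨exists_tateModule_hom_ne_zero_of_isIsogenous ℓ hℓ, fun ⟨f, hf0, hf⟩ ↦ ?_⟩
  by_contra hne
  haveI : IsEmpty (Isogeny W W') := not_nonempty_iff.mp hne
  have hmem := hspan f hf
  rw [Set.range_eq_empty, Submodule.span_empty, Submodule.mem_bot] at hmem
  exact hf0 hmem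

variable (W W')

/-- **Faltings' isogeny criterion for elliptic curves, reduced to Satz 4.** The named fact
`isIsogenous_iff_exists_tateModule_hom_ne_zero W W' ℓ` (two elliptic curves over a number field
are isogenous iff they admit a non-zero `Γ_K`-equivariant `ℤ_ℓ`-linear map `T_ℓ E → T_ℓ E'`)
follows from the named fact `mem_span_range_tateModule_map_of_equivariant W W' ℓ` (surjectivity
of `Hom_K(E, E') ⊗ ℤ_ℓ → Hom_{Γ_K}(T_ℓ E, T_ℓ E')`: Faltings, Satz 4 and Korollar 1, for elliptic
curves). Over a number field `ℓ ≠ char K = 0` automatically. The direction "isogenous ⇒" is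
unconditional (`exists_tateModule_hom_ne_zero_of_isIsogenous`).
[cite: Faltings1983Endlichkeit, §5 Satz 4, Korollar 1, Korollar 2 (i)⇔(ii)] -/
theorem isIsogenous_iff_exists_tateModule_hom_ne_zero_of_satz4
    (h : mem_span_range_tateModule_map_of_equivariant W W' ℓ) :
    isIsogenous_iff_exists_tateModule_hom_ne_zero W W' ℓ := by
  intro _ _ _
  exact isIsogenous_iff_exists_tateModule_hom_ne_zero_of_span ℓ
    (Nat.cast_ne_zero.mpr (Fact.out : ℓ.Prime).ne_zero) fun f hf ↦ h f hf

/-- **Tate's isogeny criterion for elliptic curves over a finite field, reduced to Tate's Main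
Theorem.** For elliptic curves `E, E'` over a finite field `k` and a prime `ℓ ≠ char k`:
`E, E'` are isogenous over `k` iff a non-zero `Γ_k`-equivariant `ℤ_ℓ`-linear map `T_ℓ E → T_ℓ E'`
exists, *granted* the named fact `mem_span_range_tateModule_map_of_equivariant_of_finite W W' ℓ`
(surjectivity of `Hom_k(E, E') ⊗ ℤ_ℓ → Hom_{Γ_k}(T_ℓ E, T_ℓ E')`, Tate's Main Theorem), by the
same elementary deduction. The conclusion is spelled out rather than taken to be the named fact
`isIsogenous_iff_exists_tateModule_hom_ne_zero_of_finite W W' ℓ`, whose body parses as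
`((ℓ : K) ≠ 0 → W.IsIsogenous W') ↔ ∃ f, …` (`→` binds tighter than `↔`), which is not the
intended (nor a true) statement; see `isIsogenous_of_finite_iff_exists_tateModule_hom_ne_zero`
in `FaltingsEC` for the corrected fact. [cite: Tate1966Endomorphisms, Main Theorem and Thm. 1] -/
theorem isIsogenous_iff_exists_tateModule_hom_ne_zero_of_finite_of_tate [Finite K] [W.IsElliptic]
    [W'.IsElliptic] (hℓ : (ℓ : K) ≠ 0)
    (h : mem_span_range_tateModule_map_of_equivariant_of_finite W W' ℓ) :
    W.IsIsogenous W' ↔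
      ∃ f : W.tateModule ℓ →ₗ[ℤ_[ℓ]] W'.tateModule ℓ,
        f ≠ 0 ∧ ∀ (σ : Field.absoluteGaloisGroup K) (x : W.tateModule ℓ), f (σ • x) = σ • f x :=
  isIsogenous_iff_exists_tateModule_hom_ne_zero_of_span ℓ hℓ fun f hf ↦ h hℓ f hf

end Literature.AlgebraicGeometry.Motives
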